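import Mathlib
import Literature.NumberTheory.LFunctions.Zhang2022.Section17U021ChiR1AssemblyFour
import Literature.NumberTheory.LFunctions.Zhang2022.Section17U021ChiR1Small
import Literature.NumberTheory.LFunctions.Zhang2022.Section17U021ChiR1CompositeHolds
import Literature.NumberTheory.LFunctions.Zhang2022.Section17R1PrimeBulkSmall
import Literature.NumberTheory.LFunctions.Zhang2022.Section17U021ChiR1WindowSmall
import Literature.NumberTheory.LFunctions.Zhang2022.Section17FrakACurrencyCounts
import Literature.NumberTheory.LFunctions.Zhang2022.Section17Eq177ExtCore
import Literature.NumberTheory.LFunctions.Zhang2022.Section17Eq178Chi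
import Literature.NumberTheory.LFunctions.Zhang2022.Section15CEq1522EHolds
import HarnessLib

/-!
# Zhang (2022) §17.u021 (χ-reading), remainder `R₁`: «R1Rel c′» and the leaf (17.9)ᴿᴱ from the
# three large-argument pieces (conditional edge; the unconditional closers are appended when they land)

Topic `Literature/NumberTheory/LFunctions/Zhang2022` (Landau–Siegel audit tree; verdict-neutral).
Y. Zhang, *Discrete mean estimates and the Landau–Siegel zero*, arXiv:2211.02515v1 (2022)
[Zhang2022LandauSiegel] — **an unrefereed manuscript under adjudication; nothing here asserts or denies
its Theorems 1–2, and no claim about Landau–Siegel zeros is made.** Lane ZHANG-L, WP16, leaf h17_9.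

PROVED (theorems only): `step17_u021Chi_R1Rel_of_large (c′) (hLc) (hLpB) (hLpW) : «R1Rel c′»` — the
four-piece assembly `step17_u021Chi_R1Rel_of_split4abs` with its small-argument piece DISCHARGED by
`R1_small_holds`; `eq17_9RelE_e1ppD_eventually_of_large (hLc) (hLpB) (hLpW) : ∃ c₀ ≥ 0, ∀ c′ ≥ c₀,
Eq17_9RelE e1ppD c′` — the leaf h17_9 from the three large-argument pieces alone
(`Eq177.eq17_7_eventually`, `eq17_8Chi_holds`, `Skeleton.lemma151ChiRE_e1ppD_holds`,
`eq17_9RelE_of_R1Rel`). WHAT THIS IS NOT: a proof of `hLc`, `hLpB`, `hLpW`.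

## References

* Y. Zhang, arXiv:2211.02515v1 (2022), §17 p. 98 (u020–u021), (17.9).
  [cite: Zhang2022LandauSiegel, §17 u021 p.98]
-/

noncomputable section

open Complex Real Finset
open Literature.NumberTheory.LFunctions.Zhang2022.Skeleton
open Literature.NumberTheory.LFunctions.Zhang2022.Typed.Section17

namespace Literature.NumberTheory.LFunctions.Zhang2022.Phi3Eval

/-- **«R1Rel c′» from the three LARGE-argument pieces** (`hLc` large composite, relative; `hLpB` large
prime bulk `4D⁴p ≤ T²`, `≤ ε` under (A); `hLpW` large prime window `T² < 4D⁴p`, relative) — the small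
piece is the theorem `R1_small_holds`. [cite: Zhang2022LandauSiegel, §17 u021 p.98] -/
theorem step17_u021Chi_R1Rel_of_large (c' : ℝ)
    (hLc : ∀ ε : ℝ, 0 < ε → ForAllLarge fun D _ χ => AssumptionA D χ →
      (∑ l ∈ Finset.Ico 1 (D ^ 4), ‖nu χ l‖ / l *
          ∑ q ∈ l.divisorsAntidiagonal, ∑' m₁ : ℕ, ∑' m₂ : ℕ,
            if (D : ℝ) ^ 4 < (q.2 : ℝ) * m₂ ∧ 2 ≤ m₂ ∧ ¬ m₂.Prime ∧ Nat.Coprime m₂ q.1 then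
              ‖bcoef D (q.1 * m₁)‖ * ‖nuOneStar c' χ (q.2 * m₂)‖ * ‖kappa2bar c' D (m₁ * m₂)‖ /
                ((m₁ : ℝ) * m₂)
            else 0) ≤ ε * (frakA χ + 1))
    (hLpB : ∀ ε : ℝ, 0 < ε → ForAllLarge fun D _ χ => AssumptionA D χ →
      ∑ l ∈ Finset.Ico 1 (D ^ 4), ‖nu χ l‖ / l *
        ∑ q ∈ l.divisorsAntidiagonal, ∑' m₁ : ℕ, ∑' p : ℕ,
          (if (D : ℝ) ^ 4 < q.2 * p ∧ p.Prime ∧ ¬ p ∣ q.1 ∧ 4 * (D : ℝ) ^ 4 * p ≤ bigT D ^ 2 then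
            ‖bcoef D (q.1 * m₁)‖ * ‖nuOneStar c' χ (q.2 * p)‖ * ‖kappa2bar c' D (m₁ * p)‖ /
              ((m₁ : ℝ) * p) else 0) ≤ ε)
    (hLpW : ∀ ε : ℝ, 0 < ε → ForAllLarge fun D _ χ => AssumptionA D χ →
      (∑ l ∈ Finset.Ico 1 (D ^ 4), ‖nu χ l‖ / l *
          ∑ q ∈ l.divisorsAntidiagonal, ∑' m₁ : ℕ, ∑' m₂ : ℕ,
            if ((D : ℝ) ^ 4 < (q.2 : ℝ) * m₂ ∧ m₂.Prime ∧ Nat.Coprime m₂ q.1) ∧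
                bigT D ^ 2 < 4 * (D : ℝ) ^ 4 * m₂ then
              ‖bcoef D (q.1 * m₁)‖ * ‖nuOneStar c' χ (q.2 * m₂)‖ * ‖kappa2bar c' D (m₁ * m₂)‖ /
                ((m₁ : ℝ) * m₂)
            else 0) ≤ ε * (frakA χ + 1)) :
    ∀ ε : ℝ, 0 < ε → ForAllLarge fun D _ χ => AssumptionA D χ →
      ‖∑ l ∈ Finset.Ico 1 (D ^ 4), nu χ l / (l : ℂ) *
          ∑ q ∈ l.divisorsAntidiagonal, ∑' m₁ : ℕ, ∑' m₂ : ℕ,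
            if 2 ≤ m₂ ∧ Nat.Coprime m₂ q.1 then
              bcoef D (q.1 * m₁) * χ ((q.1 * m₁ : ℕ) : ZMod D) * nuOneStar c' χ (q.2 * m₂) *
                kappa2bar c' D (m₁ * m₂) / ((m₁ : ℂ) * m₂)
            else 0‖ ≤ ε * (frakA χ + 1) :=
  step17_u021Chi_R1Rel_of_split4abs c' (R1_small_holds c') hLc hLpB hLpW

/-- **The leaf h17_9 from the three LARGE-argument pieces alone**: `∃ c₀ ≥ 0, ∀ c′ ≥ c₀,
(17.9)ᴿᴱ(e₁″_D, c′)`, by `eq17_9RelE_of_R1Rel` with (17.7) (`Eq177.eq17_7_eventually`), (17.8)-χ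
(`eq17_8Chi_holds`), Lemma 15.1-χ relative (`Skeleton.lemma151ChiRE_e1ppD_holds`) and «R1Rel c′»
(`step17_u021Chi_R1Rel_of_large`). [cite: Zhang2022LandauSiegel, §17 (17.9) p.98] -/
theorem eq17_9RelE_e1ppD_eventually_of_large
    (hLc : ∀ c' : ℝ, ∀ ε : ℝ, 0 < ε → ForAllLarge fun D _ χ => AssumptionA D χ →
      (∑ l ∈ Finset.Ico 1 (D ^ 4), ‖nu χ l‖ / l *
          ∑ q ∈ l.divisorsAntidiagonal, ∑' m₁ : ℕ, ∑' m₂ : ℕ,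
            if (D : ℝ) ^ 4 < (q.2 : ℝ) * m₂ ∧ 2 ≤ m₂ ∧ ¬ m₂.Prime ∧ Nat.Coprime m₂ q.1 then
              ‖bcoef D (q.1 * m₁)‖ * ‖nuOneStar c' χ (q.2 * m₂)‖ * ‖kappa2bar c' D (m₁ * m₂)‖ /
                ((m₁ : ℝ) * m₂)
            else 0) ≤ ε * (frakA χ + 1))
    (hLpB : ∀ c' : ℝ, ∀ ε : ℝ, 0 < ε → ForAllLarge fun D _ χ => AssumptionA D χ →
      ∑ l ∈ Finset.Ico 1 (D ^ 4), ‖nu χ l‖ / l *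
        ∑ q ∈ l.divisorsAntidiagonal, ∑' m₁ : ℕ, ∑' p : ℕ,
          (if (D : ℝ) ^ 4 < q.2 * p ∧ p.Prime ∧ ¬ p ∣ q.1 ∧ 4 * (D : ℝ) ^ 4 * p ≤ bigT D ^ 2 then
            ‖bcoef D (q.1 * m₁)‖ * ‖nuOneStar c' χ (q.2 * p)‖ * ‖kappa2bar c' D (m₁ * p)‖ /
              ((m₁ : ℝ) * p) else 0) ≤ ε)
    (hLpW : ∀ c' : ℝ, ∀ ε : ℝ, 0 < ε → ForAllLarge fun D _ χ => AssumptionA D χ →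
      (∑ l ∈ Finset.Ico 1 (D ^ 4), ‖nu χ l‖ / l *
          ∑ q ∈ l.divisorsAntidiagonal, ∑' m₁ : ℕ, ∑' m₂ : ℕ,
            if ((D : ℝ) ^ 4 < (q.2 : ℝ) * m₂ ∧ m₂.Prime ∧ Nat.Coprime m₂ q.1) ∧
                bigT D ^ 2 < 4 * (D : ℝ) ^ 4 * m₂ then
              ‖bcoef D (q.1 * m₁)‖ * ‖nuOneStar c' χ (q.2 * m₂)‖ * ‖kappa2bar c' D (m₁ * m₂)‖ /
                ((m₁ : ℝ) * m₂)
            else 0) ≤ ε * (frakA χ + 1)) :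
    ∃ c₀ : ℝ, 0 ≤ c₀ ∧ ∀ c' : ℝ, c₀ ≤ c' → Typed.Section17.Eq17_9RelE e1ppD c' := by
  obtain ⟨c₀, hc₀, h7⟩ := Eq177.eq17_7_eventually
  exact ⟨c₀, hc₀, fun c' hc' =>
    eq17_9RelE_of_R1Rel e1ppD c' (h7 c' hc') (eq17_8Chi_holds c')
      (step17_u021Chi_R1Rel_of_large c' (hLc c') (hLpB c') (hLpW c'))
      (Skeleton.lemma151ChiRE_e1ppD_holds c')⟩

/-! ## After `hLc` landed (`Typed.Section17.R1_composite_large_small`, zl-w14-p2 p491603): the prime pieces alone -/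

/-- **«R1Rel c′» from the two LARGE-PRIME pieces** (`hLpB` bulk `4D⁴p ≤ T²`, `≤ ε` under (A), zl-w16-p3's
text; `hLpW` window `T² < 4D⁴p`, relative, zl-closer-1's text) — the small piece (`R1_small_holds`) and
the large-composite piece (`Typed.Section17.R1_composite_large_small`) are theorems.
[cite: Zhang2022LandauSiegel, §17 u021 p.98] -/
theorem step17_u021Chi_R1Rel_of_prime_pieces (c' : ℝ)
    (hLpB : ∀ ε : ℝ, 0 < ε → ForAllLarge fun D _ χ => AssumptionA D χ →
      ∑ l ∈ Finset.Ico 1 (D ^ 4), ‖nu χ l‖ / l *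
        ∑ q ∈ l.divisorsAntidiagonal, ∑' m₁ : ℕ, ∑' p : ℕ,
          (if (D : ℝ) ^ 4 < q.2 * p ∧ p.Prime ∧ ¬ p ∣ q.1 ∧ 4 * (D : ℝ) ^ 4 * p ≤ bigT D ^ 2 then
            ‖bcoef D (q.1 * m₁)‖ * ‖nuOneStar c' χ (q.2 * p)‖ * ‖kappa2bar c' D (m₁ * p)‖ /
              ((m₁ : ℝ) * p) else 0) ≤ ε)
    (hLpW : ∀ ε : ℝ, 0 < ε → ForAllLarge fun D _ χ => AssumptionA D χ →
      (∑ l ∈ Finset.Ico 1 (D ^ 4), ‖nu χ l‖ / l *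
          ∑ q ∈ l.divisorsAntidiagonal, ∑' m₁ : ℕ, ∑' m₂ : ℕ,
            if ((D : ℝ) ^ 4 < (q.2 : ℝ) * m₂ ∧ m₂.Prime ∧ Nat.Coprime m₂ q.1) ∧
                bigT D ^ 2 < 4 * (D : ℝ) ^ 4 * m₂ then
              ‖bcoef D (q.1 * m₁)‖ * ‖nuOneStar c' χ (q.2 * m₂)‖ * ‖kappa2bar c' D (m₁ * m₂)‖ /
                ((m₁ : ℝ) * m₂)
            else 0) ≤ ε * (frakA χ + 1)) :
    ∀ ε : ℝ, 0 < ε → ForAllLarge fun D _ χ => AssumptionA D χ →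
      ‖∑ l ∈ Finset.Ico 1 (D ^ 4), nu χ l / (l : ℂ) *
          ∑ q ∈ l.divisorsAntidiagonal, ∑' m₁ : ℕ, ∑' m₂ : ℕ,
            if 2 ≤ m₂ ∧ Nat.Coprime m₂ q.1 then
              bcoef D (q.1 * m₁) * χ ((q.1 * m₁ : ℕ) : ZMod D) * nuOneStar c' χ (q.2 * m₂) *
                kappa2bar c' D (m₁ * m₂) / ((m₁ : ℂ) * m₂)
            else 0‖ ≤ ε * (frakA χ + 1) :=
  step17_u021Chi_R1Rel_of_large c' (Typed.Section17.R1_composite_large_small c') hLpB hLpW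

/-- **The leaf h17_9 from the two LARGE-PRIME pieces alone**: `∃ c₀ ≥ 0, ∀ c′ ≥ c₀, (17.9)ᴿᴱ(e₁″_D, c′)`.
[cite: Zhang2022LandauSiegel, §17 (17.9) p.98] -/
theorem eq17_9RelE_e1ppD_eventually_of_prime_pieces
    (hLpB : ∀ c' : ℝ, ∀ ε : ℝ, 0 < ε → ForAllLarge fun D _ χ => AssumptionA D χ →
      ∑ l ∈ Finset.Ico 1 (D ^ 4), ‖nu χ l‖ / l *
        ∑ q ∈ l.divisorsAntidiagonal, ∑' m₁ : ℕ, ∑' p : ℕ,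
          (if (D : ℝ) ^ 4 < q.2 * p ∧ p.Prime ∧ ¬ p ∣ q.1 ∧ 4 * (D : ℝ) ^ 4 * p ≤ bigT D ^ 2 then
            ‖bcoef D (q.1 * m₁)‖ * ‖nuOneStar c' χ (q.2 * p)‖ * ‖kappa2bar c' D (m₁ * p)‖ /
              ((m₁ : ℝ) * p) else 0) ≤ ε)
    (hLpW : ∀ c' : ℝ, ∀ ε : ℝ, 0 < ε → ForAllLarge fun D _ χ => AssumptionA D χ →
      (∑ l ∈ Finset.Ico 1 (D ^ 4), ‖nu χ l‖ / l *
          ∑ q ∈ l.divisorsAntidiagonal, ∑' m₁ : ℕ, ∑' m₂ : ℕ,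
            if ((D : ℝ) ^ 4 < (q.2 : ℝ) * m₂ ∧ m₂.Prime ∧ Nat.Coprime m₂ q.1) ∧
                bigT D ^ 2 < 4 * (D : ℝ) ^ 4 * m₂ then
              ‖bcoef D (q.1 * m₁)‖ * ‖nuOneStar c' χ (q.2 * m₂)‖ * ‖kappa2bar c' D (m₁ * m₂)‖ /
                ((m₁ : ℝ) * m₂)
            else 0) ≤ ε * (frakA χ + 1)) :
    ∃ c₀ : ℝ, 0 ≤ c₀ ∧ ∀ c' : ℝ, c₀ ≤ c' → Typed.Section17.Eq17_9RelE e1ppD c' :=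
  eq17_9RelE_e1ppD_eventually_of_large (fun c' => Typed.Section17.R1_composite_large_small c')
    hLpB hLpW

/-! ## THE CLOSERS — every piece is a tree theorem (hS owner p490746 · hLc zl-w14-p2 p491603 ·
hLpB zl-w16-p2/zl-w16-p3 p493069 · hLpW zl-closer-1 p492364; inputs M1 zl-w11-p3, M2s zl-w10-p5,
A1 zl-libB-typer) -/

/-- **«R1Rel c′» HOLDS, unconditionally** (ZHANG-L, WP16, sub-leaf `R₁` of `Step17_u021Chi` in the
relative currency `ε(𝔞+1)`): the remainder `R₁` of the §17.u021 χ-reading decomposition — the terms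
with `m₂ ≥ 2` — is `o(𝔞+1)` under (A), for every `c′`. This is the hypothesis `hR₁` of
`step17_u024ChiRelE_of_R1Rel` / `eq17_9RelE_of_R1Rel` VERBATIM. Composition BY NAME:
`step17_u021Chi_R1Rel_of_prime_pieces` (hS := `R1_small_holds`, hLc := `R1_composite_large_small`
inside) with hLpB := `R1_prime_bulk_small c′ (m1Sum_le c′)` and hLpW :=
`R1_prime_window_small c′ sum_nu_tau_tau_div_le_frakA_sq_ell`.
[cite: Zhang2022LandauSiegel, §17 u021 p.98] -/
theorem step17_u021Chi_R1Rel_holds (c' : ℝ) :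
    ∀ ε : ℝ, 0 < ε → ForAllLarge fun D _ χ => AssumptionA D χ →
      ‖∑ l ∈ Finset.Ico 1 (D ^ 4), nu χ l / (l : ℂ) *
          ∑ q ∈ l.divisorsAntidiagonal, ∑' m₁ : ℕ, ∑' m₂ : ℕ,
            if 2 ≤ m₂ ∧ Nat.Coprime m₂ q.1 then
              bcoef D (q.1 * m₁) * χ ((q.1 * m₁ : ℕ) : ZMod D) * nuOneStar c' χ (q.2 * m₂) *
                kappa2bar c' D (m₁ * m₂) / ((m₁ : ℂ) * m₂)
            else 0‖ ≤ ε * (frakA χ + 1) :=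
  step17_u021Chi_R1Rel_of_prime_pieces c' (R1_prime_bulk_small c' (m1Sum_le c'))
    (R1_prime_window_small c' sum_nu_tau_tau_div_le_frakA_sq_ell)

/-- **The node `Step17_u024ChiRelE e₁″_D c′` HOLDS** for every `c′` (the χ-reading (17.9) input in the
relative `E`-currency), from «R1Rel c′» and Lemma 15.1-χ relative (`Skeleton.lemma151ChiRE_e1ppD_holds`).
[cite: Zhang2022LandauSiegel, §17 u024 p.98] -/
theorem step17_u024ChiRelE_e1ppD_holds (c' : ℝ) : Step17_u024ChiRelE e1ppD c' :=
  step17_u024ChiRelE_of_R1Rel e1ppD c' (step17_u021Chi_R1Rel_holds c')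
    (Skeleton.lemma151ChiRE_e1ppD_holds c')

end Literature.NumberTheory.LFunctions.Zhang2022.Phi3Eval

namespace Literature.NumberTheory.LFunctions.Zhang2022.Typed.Section17

open Literature.NumberTheory.LFunctions.Zhang2022.Skeleton

/-- **LEAF h17_9 CLOSED — (17.9) in the relative `E`-currency at `e₁″_D`, eventually in `c′`:**
`∃ c₀ ≥ 0, ∀ c′ ≥ c₀, Eq17_9RelE e1ppD c′` (the skeleton's binder shape), from (17.7)
(`Eq177.eq17_7_eventually`), (17.8)-χ (`eq17_8Chi_holds`), Lemma 15.1-χ relative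
(`Skeleton.lemma151ChiRE_e1ppD_holds`) and «R1Rel c′» (`Phi3Eval.step17_u021Chi_R1Rel_holds`), via
`Phi3Eval.eq17_9RelE_e1ppD_eventually_of_prime_pieces`. [cite: Zhang2022LandauSiegel, §17 (17.9) p.98] -/
theorem eq17_9RelE_e1ppD_eventually :
    ∃ c₀ : ℝ, 0 ≤ c₀ ∧ ∀ c' : ℝ, c₀ ≤ c' → Eq17_9RelE e1ppD c' :=
  Phi3Eval.eq17_9RelE_e1ppD_eventually_of_prime_pieces
    (fun c' => Phi3Eval.R1_prime_bulk_small c' (m1Sum_le c'))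
    (fun c' => R1_prime_window_small c' sum_nu_tau_tau_div_le_frakA_sq_ell)

/-- **(17.9)ᴿᴱ at `e₁″_D` for each `c′ ≥ c₀`** — pointwise form of `eq17_9RelE_e1ppD_eventually` with the
threshold exposed. [cite: Zhang2022LandauSiegel, §17 (17.9) p.98] -/
theorem eq17_9RelE_e1ppD_of_le {c₀ c' : ℝ} (h₀ : c₀ = Classical.choose eq17_9RelE_e1ppD_eventually)
    (hc : c₀ ≤ c') : Eq17_9RelE e1ppD c' := by
  subst h₀
  exact (Classical.choose_spec eq17_9RelE_e1ppD_eventually).2 c' hc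

end Literature.NumberTheory.LFunctions.Zhang2022.Typed.Section17
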